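import Mathlib.Analysis.SpecialFunctions.Integrals.Basic
import Mathlib.MeasureTheory.Integral.DominatedConvergence
import Mathlib.Analysis.SpecialFunctions.Trigonometric.Basic
import HarnessLib

/-!
# Orthogonality of the lattice cosine modes on `[−π, π]` (Parseval at zero for `ℓ¹` sequences)

Topic `Literature/Analysis/Fourier`; theorems only. For an absolutely summable real sequence `c : ℤ → ℝ` the cosine
series `k ↦ Σ_x cos(kx) c_x` (the even part of its Fourier transform on the circle) integrates over a period to the
zeroth coefficient: `∫_{−π}^{π} Σ_x cos(kx) c_x dk = 2π c_0` (`integral_tsum_cos_mul_eq`), by termwise integration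
(dominated convergence with the constant majorant `|c_x|`) and `∫_{−π}^{π} cos(kx) dk = 0` for `x ≠ 0`
(`intervalIntegral_cos_mul_int`). This is the Parseval-at-zero identity used to read off the return value of a
positive-definite lattice sequence from its transform. Everything is proved; tagged `[folklore]`.
-/

noncomputable section

open MeasureTheory Filter Set intervalIntegral

namespace Literature.Analysis.Fourier

/-- `∫_{−π}^{π} cos(k·x) dk` equals `2π` for `x = 0` and `0` for a non-zero integer `x`. [folklore] -/
theorem intervalIntegral_cos_mul_int (x : ℤ) :
    ∫ k in (-Real.pi)..Real.pi, Real.cos (k * (x : ℝ)) = if x = 0 then 2 * Real.pi else 0 := by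
  split_ifs with hx
  · subst hx
    simp only [Int.cast_zero, mul_zero, Real.cos_zero, intervalIntegral.integral_const, smul_eq_mul, mul_one]
    ring
  · have hx' : (x : ℝ) ≠ 0 := by exact_mod_cast hx
    have h1 : Real.sin (Real.pi * (x : ℝ)) = 0 := by
      rw [mul_comm]; exact Real.sin_int_mul_pi x
    have h2 : Real.sin (-Real.pi * (x : ℝ)) = 0 := by
      rw [neg_mul, Real.sin_neg, h1, neg_zero]
    rw [intervalIntegral.integral_comp_mul_right Real.cos hx', integral_cos, h1, h2]
    simp

/-- **Parseval at zero for an `ℓ¹` cosine series**: `∫_{−π}^{π} Σ_x cos(kx) c_x dk = 2π c_0` for absolutely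
summable `c : ℤ → ℝ` (termwise integration by dominated convergence). [folklore] -/
theorem integral_tsum_cos_mul_eq (c : ℤ → ℝ) (hc : Summable fun x : ℤ => |c x|) :
    ∫ k in (-Real.pi)..Real.pi, ∑' x : ℤ, Real.cos (k * (x : ℝ)) * c x = 2 * Real.pi * c 0 := by
  have hmode : ∀ x : ℤ, ∫ k in (-Real.pi)..Real.pi, Real.cos (k * (x : ℝ)) * c x
      = if x = 0 then 2 * Real.pi * c 0 else 0 := by
    intro x
    rw [intervalIntegral.integral_mul_const, intervalIntegral_cos_mul_int]
    split_ifs with hx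
    · subst hx; ring
    · ring
  have hbd : ∀ (x : ℤ) (k : ℝ), ‖Real.cos (k * (x : ℝ)) * c x‖ ≤ |c x| := fun x k => by
    rw [Real.norm_eq_abs, abs_mul]
    exact mul_le_of_le_one_left (abs_nonneg _) (Real.abs_cos_le_one _)
  have hsum : HasSum (fun x : ℤ => ∫ k in (-Real.pi)..Real.pi, Real.cos (k * (x : ℝ)) * c x)
      (∫ k in (-Real.pi)..Real.pi, ∑' x : ℤ, Real.cos (k * (x : ℝ)) * c x) := by
    refine intervalIntegral.hasSum_integral_of_dominated_convergence (fun x _ => |c x|)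
      (fun x => ?_) (fun x => ?_) ?_ ?_ ?_
    · exact ((Real.continuous_cos.comp (continuous_id.mul continuous_const)).mul
        continuous_const).aestronglyMeasurable
    · exact Eventually.of_forall fun k _ => hbd x k
    · exact Eventually.of_forall fun k _ => hc
    · exact intervalIntegrable_const
    · exact Eventually.of_forall fun k _ => (Summable.of_norm_bounded hc (fun x => hbd x k)).hasSum
  have hite : HasSum (fun x : ℤ => if x = 0 then 2 * Real.pi * c 0 else (0 : ℝ))
      (∫ k in (-Real.pi)..Real.pi, ∑' x : ℤ, Real.cos (k * (x : ℝ)) * c x) := by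
    simp only [hmode] at hsum
    exact hsum
  exact hite.unique (hasSum_ite_eq (0 : ℤ) (2 * Real.pi * c 0))

end Literature.Analysis.Fourier

end
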